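import Summits.Langlands.Langlands.Theses.IrreducibilityBySelfDuality
import Literature.NumberTheory.Automorphic.SelfdualGL3AdjointLiftProofs
import Literature.NumberTheory.Automorphic.AutomorphicRepsGLOneHeckeCharacter
import Literature.NumberTheory.Automorphic.BockleHuiIrreducibleGL3AnalyticProofs
import Literature.NumberTheory.Automorphic.ArtinLFunctionsAbelianProofs
import HarnessLib

/-!
# `SelfdualGL3AdjointLift` (route IrreducibilityBySelfDuality, item stmt-Langlands-13621) is
Ramakrishnan 2014, Theorem A, transported through the `GL(1)` dictionary

The route item `Summit.Langlands.Langlands.Theses.IrreducibilityBySelfDuality.SelfdualGL3AdjointLift`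
restates Ramakrishnan's Theorem A (D. Ramakrishnan, *An exercise concerning the selfdual cusp forms
on GL(3)*, Indian J. Pure Appl. Math. 45 (2014), Thm. A and the remark following it; for a general
twisting character: A. Shavali, IMRN 2026, Lemma 4.7) at the level of Satake parameters, exactly as
the Literature named fact `Literature.NumberTheory.Automorphic.Ramakrishnan2014_selfdualGL3_adjointLift`
does, with two purely notational differences imposed by the route's import cone:

* the Hecke characters `η` (with `Π^∨ ≃ Π ⊗ η`) and `ν` (with `Π ≃ Ad(π) ⊗ ν`, `ν² η = 1`) are
  carried as cuspidal Borel–Jacquet data on `GL₁(𝔸_F)` (`CuspidalAutomorphicRepData 1 F hF1`), and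
  "`η` unramified at `v` with `η(ϖ_v) = e`" as the singleton Satake parameter `{e}` at `v`;
* `adParams β = {x/y, y/x, 1}` and `quadraticSign L v` (`+1` iff some place of `L` over `v` has
  residue degree `1`) are inlined by their defining terms (definitionally equal).

This file proves that the item and the named fact are **equivalent**
(`selfdualGL3AdjointLift_iff_ramakrishnan2014`), through the `GL(1)` dictionary of the tree, all
of it proved: every cuspidal `GL(1)` datum has a Hecke character
(`AutomorphicRepData.exists_heckeCharacter_glOne`) whose values at uniformizers are its Satake
parameters almost everywhere (`exists_eq_singleton_of_hasSatakeParamAt_glOne`,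
`eventually_hasSatakeParamAt_glOne`, `HeckeCharacter.localComponent_eq_valueAtUniformizer`,
`HeckeCharacter.isUnramifiedAt_cofinite_holds`); every Hecke character is the Hecke character of a
cuspidal `GL(1)` datum (`exists_cuspidal_glOne_hasSatakeParamAt_valueAtUniformizer`); Satake
parameters are unique and exist almost everywhere (Flath: `hasSatakeParamAt_unique_holds`,
`hasSatakeParamAt_cofinite_holds`); and a Hecke character is determined by almost all of its values
at uniformizers (`HeckeCharacter.ext_of_eventually_valueAtUniformizer_eq`), which turns the
placewise identity `d² e = 1` back into `ν² η = 1`.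

Consequences recorded here:

* `SelfdualGL3AdjointLift_of_ramakrishnan2014` — the item from the named fact (a CONDITIONAL proof
  of the item: its trust base is exactly `Ramakrishnan2014_selfdualGL3_adjointLift`, whose
  discharge is reduced in `SelfdualGL3AdjointLiftProofs` to the bare Ginzburg–Rallis–Soudry /
  Labesse–Langlands descent `GL(3) → SL(2) → GL(2)`, which has no carrier in the tree);
* `ramakrishnan2014_of_SelfdualGL3AdjointLift` — conversely the item implies the named fact, so
  the item is not a weakening of Theorem A: nothing short of Theorem A closes it;
* `SelfdualGL3AdjointLift_of_selfdualLift_of_JS` — the item from the bare descent statement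
  ("every cuspidal `Π` on `GL₃` with selfdual Satake parameters a.e. is `Ad(π) ⊗ ν` a.e., `ν² = 1`")
  and Jacquet–Shalika (2.2), (2.3) for Borel–Jacquet data
  (`Ramakrishnan2014_selfdualGL3_adjointLift.of_selfdualLift_of_JS`): the minimal printed input.

References: Ramakrishnan 2014, Thm. A and remark p. 777 [Ramakrishnan2014]; Shavali 2026,
Lemma 4.7 [Shavali2026]; Borel–Jacquet, Corvallis 1979, §4.6 (automorphic representations of
`GL(1)` = idèle class characters) [BorelJacquetCorvallis1979]; Flath, Corvallis 1979, Thm. 3.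
-/

noncomputable section

set_option linter.dupNamespace false -- project-wide option (lakefile weak.linter.dupNamespace); `Summit.Langlands.Langlands` is the mandated namespace

open scoped NumberField Classical
open Filter IsDedekindDomain NumberField
open Literature.NumberTheory.Automorphic Literature.NumberTheory.GaloisRepresentations

namespace Summit.Langlands.Langlands.Theorems

open Summit.Langlands.Langlands.Theses.IrreducibilityBySelfDuality (SelfdualGL3AdjointLift)

/-! ### The `GL(1)` dictionary at Satake level -/

section GLOne

variable {F : Type} [Field F] [NumberField F] {h1 : isCompact_glFiniteIntegralLevel 1 F}

/-- **Satake parameters of a `GL(1)` datum are the values of its Hecke character, almost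
everywhere.** If `χ` is the Hecke character of the automorphic representation `η = W / W'` of
`GL₁(𝔸_F)` (every `g` acts on `W / W'` by `χ(det g)`), then at almost every finite place `v` every
Satake parameter of `η` at `v` is the singleton `{χ(ϖ_v)}`: by
`exists_eq_singleton_of_hasSatakeParamAt_glOne` it is `{χ_v(ϖ)}` for *some* uniformizer `ϖ`, and
at the (cofinitely many, `isUnramifiedAt_cofinite_holds`) places where `χ` is unramified this does
not depend on the uniformizer (`localComponent_eq_valueAtUniformizer`). Borel–Jacquet 1979, §4.6;
Tate 1950, §2.5. [cite: BorelJacquetCorvallis1979, §4.6] -/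
theorem eventually_eq_singleton_valueAtUniformizer_glOne
    (η : AutomorphicRepData (AutomorphyDatum.gl 1 F h1)) {χ : HeckeCharacter F}
    (hχ : ∀ (g : (AdelicGroupData.gl 1 F).Adelic), ∀ φ ∈ η.W,
      rightTranslation (AdelicGroupData.gl 1 F) g φ -
        ((χ (Matrix.GeneralLinearGroup.det g) : ℂˣ) : ℂ) • φ ∈ η.W') :
    ∀ᶠ v : HeightOneSpectrum (𝓞 F) in cofinite, χ.IsUnramifiedAt v ∧ ∀ α : Multiset ℂ,
      η.HasSatakeParamAt v α → α = {χ.valueAtUniformizer v} := by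
  filter_upwards [HeckeCharacter.isUnramifiedAt_cofinite_holds χ] with v hv
  refine ⟨hv, fun α hα => ?_⟩
  obtain ⟨ϖ, hϖ, rfl⟩ := η.exists_eq_singleton_of_hasSatakeParamAt_glOne hχ hα
  rw [← HeckeCharacter.localComponent_apply, HeckeCharacter.localComponent_eq_valueAtUniformizer hv hϖ]

/-- **Almost everywhere, `{χ(ϖ_v)}` is a Satake parameter of the `GL(1)` datum with Hecke
character `χ`** (`eventually_hasSatakeParamAt_glOne` at the chosen uniformizer `ϖ_v`,
`HeckeCharacter.valued_uniformizer`). Borel–Jacquet 1979, §4.6. [cite: BorelJacquetCorvallis1979, §4.6] -/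
theorem eventually_hasSatakeParamAt_valueAtUniformizer_glOne
    (η : AutomorphicRepData (AutomorphyDatum.gl 1 F h1)) {χ : HeckeCharacter F}
    (hχ : ∀ (g : (AdelicGroupData.gl 1 F).Adelic), ∀ φ ∈ η.W,
      rightTranslation (AdelicGroupData.gl 1 F) g φ -
        ((χ (Matrix.GeneralLinearGroup.det g) : ℂˣ) : ℂ) • φ ∈ η.W') :
    ∀ᶠ v : HeightOneSpectrum (𝓞 F) in cofinite, η.HasSatakeParamAt v {χ.valueAtUniformizer v} := by
  filter_upwards [η.eventually_hasSatakeParamAt_glOne hχ] with v hv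
  exact hv (HeckeCharacter.uniformizer F v) (HeckeCharacter.valued_uniformizer v)

end GLOne

/-! ### The item from the named fact -/

/-- **`SelfdualGL3AdjointLift` from Ramakrishnan 2014, Theorem A** (the Literature named fact
`Ramakrishnan2014_selfdualGL3_adjointLift`, essentially selfdual form: Ramakrishnan 2014, Thm. A and
the remark p. 777; Shavali 2026, Lemma 4.7). Given `P` cuspidal on `GL₃(𝔸_F)` and a cuspidal
`GL(1)` datum `η` with, a.e., `η` having Satake parameter `{e}` and `t_{P,v}⁻¹ = e · t_{P,v}`: let `χ`
be the Hecke character of `η` (`exists_heckeCharacter_glOne`); a.e. `e = χ(ϖ_v)` with `χ`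
unramified (`eventually_eq_singleton_valueAtUniformizer_glOne`), so the named fact applies to
`(P, χ)` and yields a non-dihedral cuspidal `π` on `GL₂(𝔸_F)` and a Hecke character `ν` with
`ν² χ = 1` and `t_{P,v} = ν(ϖ_v) Ad(t_{π,v})` a.e.; the `GL(1)` datum of `ν`
(`exists_cuspidal_glOne_hasSatakeParamAt_valueAtUniformizer`) has Satake parameter `{ν(ϖ_v)}` a.e.,
`η` has `{χ(ϖ_v)}` a.e. (`eventually_hasSatakeParamAt_valueAtUniformizer_glOne`), and
`ν(ϖ_v)² χ(ϖ_v) = (ν² χ)(ϖ_v) = 1`. Non-dihedrality and `Ad` are the inlined `quadraticSign` /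
`adParams`, definitionally. CONDITIONAL on the named fact (hypothesis `h`).
[cite: Ramakrishnan2014, Theorem A and the remark following it, p. 777]
[cite: Shavali2026, Lemma 4.7] -/
theorem SelfdualGL3AdjointLift_of_ramakrishnan2014 (h : Ramakrishnan2014_selfdualGL3_adjointLift) :
    SelfdualGL3AdjointLift := by
  intro F _ _ hF1 hF2 hF3 P η hsd
  -- the Hecke character of `η`
  obtain ⟨χ, hχ⟩ := η.1.exists_heckeCharacter_glOne
  -- hypothesis of the named fact for `(P, χ)`
  have hsd' : ∀ᶠ v : HeightOneSpectrum (𝓞 F) in cofinite, ∀ α : Multiset ℂ,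
      P.1.HasSatakeParamAt v α →
        χ.IsUnramifiedAt v ∧ α.map (fun a => a⁻¹) = α.map (fun a => χ.valueAtUniformizer v * a) := by
    filter_upwards [hsd, eventually_eq_singleton_valueAtUniformizer_glOne η.1 hχ] with v hv hχv α hα
    obtain ⟨e, he, hαe⟩ := hv α hα
    have hee : e = χ.valueAtUniformizer v := Multiset.singleton_inj.mp (hχv.2 {e} he)
    exact ⟨hχv.1, hee ▸ hαe⟩
  obtain ⟨π, ν, hnd, hν, hsat⟩ := h F hF2 hF3 P χ hsd'
  -- `ν` as a `GL(1)` datum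
  obtain ⟨τ, hτ⟩ := exists_cuspidal_glOne_hasSatakeParamAt_valueAtUniformizer hF1 ν
  refine ⟨π, τ, fun L _ _ _ hL => hnd L hL, ?_⟩
  filter_upwards [hsat, hτ, eventually_hasSatakeParamAt_valueAtUniformizer_glOne η.1 hχ]
    with v hv hτv hηv β hβ
  refine ⟨ν.valueAtUniformizer v, χ.valueAtUniformizer v, hτv, hηv, ?_, (hv β hβ).2⟩
  have e1 := congrArg (fun θ : HeckeCharacter F => θ.valueAtUniformizer v) hν
  simpa only [HeckeCharacter.valueAtUniformizer_mul, heckeCharacter_valueAtUniformizer_sq,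
    HeckeCharacter.valueAtUniformizer_one] using e1

/-! ### The named fact from the item -/

/-- **Conversely, `SelfdualGL3AdjointLift` implies Ramakrishnan's Theorem A as vendored**
(`Ramakrishnan2014_selfdualGL3_adjointLift`): given `Π^∨ ≃ Π ⊗ η` at Satake level for a Hecke
character `η`, realise `η` as a cuspidal `GL(1)` datum `τ` with Satake parameter `{η(ϖ_v)}` a.e.
(`exists_cuspidal_glOne_hasSatakeParamAt_valueAtUniformizer`, with the proved compactness
`isCompact_glFiniteIntegralLevel_holds 1 F` typing it), apply the item, and let `ν` be the Hecke
character of the `GL(1)` datum `ν'` it returns (`exists_heckeCharacter_glOne`). At almost every `v`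
the place `v` is unramified for `π` (Flath, `hasSatakeParamAt_cofinite_holds`), the item's `d` is
`ν(ϖ_v)` (`eventually_eq_singleton_valueAtUniformizer_glOne`) and its `e` is `η(ϖ_v)` (uniqueness of
Satake parameters of `τ`, `hasSatakeParamAt_unique_holds`); so `(ν² η)(ϖ_v) = d² e = 1` a.e., whence
`ν² η = 1` by the rigidity of Hecke characters (`ext_of_eventually_valueAtUniformizer_eq`,
Cassels–Fröhlich VII Prop. 4.1), and `t_{Π,v} = ν(ϖ_v) Ad(t_{π,v})` a.e.
[cite: Ramakrishnan2014, Theorem A and the remark following it, p. 777]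
[cite: BorelJacquetCorvallis1979, §4.6] -/
theorem ramakrishnan2014_of_SelfdualGL3AdjointLift (h : SelfdualGL3AdjointLift) :
    Ramakrishnan2014_selfdualGL3_adjointLift := by
  intro F _ _ hF2 hF3 P η hsd
  have hF1 : isCompact_glFiniteIntegralLevel 1 F := isCompact_glFiniteIntegralLevel_holds 1 F
  -- `η` as a `GL(1)` datum
  obtain ⟨τ, hτ⟩ := exists_cuspidal_glOne_hasSatakeParamAt_valueAtUniformizer hF1 η
  have hsd' : ∀ᶠ v : HeightOneSpectrum (𝓞 F) in cofinite, ∀ α : Multiset ℂ,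
      P.1.HasSatakeParamAt v α → ∃ e : ℂ, τ.1.HasSatakeParamAt v {e} ∧
        α.map (fun a => a⁻¹) = α.map (fun a => e * a) := by
    filter_upwards [hsd, hτ] with v hv hτv α hα
    exact ⟨_, hτv, (hv α hα).2⟩
  obtain ⟨π, ν', hnd, hsat⟩ := h F hF1 hF2 hF3 P τ hsd'
  -- the Hecke character of `ν'`
  obtain ⟨ν, hν⟩ := ν'.1.exists_heckeCharacter_glOne
  have key : ∀ᶠ v : HeightOneSpectrum (𝓞 F) in cofinite,
      ν.IsUnramifiedAt v ∧ ν.valueAtUniformizer v ^ 2 * η.valueAtUniformizer v = 1 ∧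
        ∀ β : Multiset ℂ, π.1.HasSatakeParamAt v β →
          P.1.HasSatakeParamAt v ((adParams β).map fun c => ν.valueAtUniformizer v * c) := by
    filter_upwards [hsat, eventually_eq_singleton_valueAtUniformizer_glOne ν'.1 hν, hτ,
      π.1.hasSatakeParamAt_cofinite_holds] with v hv hνv hτv hunr
    have aux : ∀ β : Multiset ℂ, π.1.HasSatakeParamAt v β →
        ν.valueAtUniformizer v ^ 2 * η.valueAtUniformizer v = 1 ∧
          P.1.HasSatakeParamAt v ((adParams β).map fun c => ν.valueAtUniformizer v * c) := by
      intro β hβ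
      obtain ⟨d, e, hd, he, hde, hP⟩ := hv β hβ
      have hd' : d = ν.valueAtUniformizer v := Multiset.singleton_inj.mp (hνv.2 {d} hd)
      have he' : e = η.valueAtUniformizer v :=
        Multiset.singleton_inj.mp (τ.1.hasSatakeParamAt_unique_holds he hτv)
      subst hd' he'
      exact ⟨hde, hP⟩
    obtain ⟨β₀, hβ₀⟩ := hunr
    exact ⟨hνv.1, (aux β₀ hβ₀).1, fun β hβ => (aux β hβ).2⟩
  refine ⟨π, ν, hnd, ?_, ?_⟩
  · refine HeckeCharacter.ext_of_eventually_valueAtUniformizer_eq ?_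
    filter_upwards [key] with v hv
    rw [HeckeCharacter.valueAtUniformizer_mul, heckeCharacter_valueAtUniformizer_sq, hv.2.1,
      HeckeCharacter.valueAtUniformizer_one]
  · filter_upwards [key] with v hv β hβ
    exact ⟨hv.1, hv.2.2 β hβ⟩

/-- **The route item is equivalent to the Literature named fact** `Ramakrishnan2014_selfdualGL3_adjointLift`
(Ramakrishnan 2014, Theorem A, essentially selfdual Satake-level form): the two differ only by the
`GL(1)` dictionary (Hecke characters ↔ cuspidal Borel–Jacquet data on `GL₁`) and the inlining of
`adParams` / `quadraticSign`. [cite: Ramakrishnan2014, Theorem A and the remark following it, p. 777] -/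
theorem selfdualGL3AdjointLift_iff_ramakrishnan2014 :
    SelfdualGL3AdjointLift ↔ Ramakrishnan2014_selfdualGL3_adjointLift :=
  ⟨ramakrishnan2014_of_SelfdualGL3AdjointLift, SelfdualGL3AdjointLift_of_ramakrishnan2014⟩

/-- **The item from the bare descent statement and Jacquet–Shalika (2.2), (2.3).** By
`Ramakrishnan2014_selfdualGL3_adjointLift.of_selfdualLift_of_JS` (the printed proof of Theorem A
mapped onto the tree: central characters, the twist to the selfdual case, and "`π` is not dihedral
because `Π` is cuspidal" are proved there), the item follows from (i) the descent statement
"every cuspidal `Π` on `GL₃(𝔸_F)` with selfdual Satake parameters a.e. is `Ad(π) ⊗ ν` a.e. for a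
cuspidal `π` on `GL₂(𝔸_F)` and a Hecke character `ν` with `ν² = 1`" (hypothesis `hA'`: the pole of
`L^S(s, Π, sym²)`, the Ginzburg–Rallis–Soudry descent `GL(3) → SL(2)` and Labesse–Langlands
`SL(2) → GL(2)` — the part of the printed proof with no carrier in the tree) and (ii) the
Jacquet–Shalika facts (2.2), (2.3) for Borel–Jacquet data. This names the minimal printed input the
item is waiting for. [cite: Ramakrishnan2014, Theorem A and its proof]
[cite: ArthurClozelAMS120, Ch. 3 §2 (2.2), (2.3)] -/
theorem SelfdualGL3AdjointLift_of_selfdualLift_of_JS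
    (hA' : ∀ (F : Type) [Field F] [NumberField F] (hF2 : isCompact_glFiniteIntegralLevel 2 F)
      (hF3 : isCompact_glFiniteIntegralLevel 3 F) (P : CuspidalAutomorphicRepData 3 F hF3),
      (∀ᶠ v : HeightOneSpectrum (𝓞 F) in Filter.cofinite, ∀ α : Multiset ℂ,
          P.1.HasSatakeParamAt v α → α.map (fun a => a⁻¹) = α) →
      ∃ (π : CuspidalAutomorphicRepData 2 F hF2) (ν : HeckeCharacter F),
        ν ^ 2 = 1 ∧
        ∀ᶠ v : HeightOneSpectrum (𝓞 F) in Filter.cofinite, ∀ β : Multiset ℂ,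
          π.1.HasSatakeParamAt v β →
            ν.IsUnramifiedAt v ∧
              P.1.HasSatakeParamAt v ((adParams β).map fun c => ν.valueAtUniformizer v * c))
    (hJ2 : JacquetShalika1981_partialPairL_boundary_repData)
    (hJ3 : JacquetShalika1981_partialPairL_pole_repData) :
    SelfdualGL3AdjointLift :=
  SelfdualGL3AdjointLift_of_ramakrishnan2014
    (Ramakrishnan2014_selfdualGL3_adjointLift.of_selfdualLift_of_JS hA' hJ2 hJ3)

end Summit.Langlands.Langlands.Theorems

end
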